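import Summits.MatrixMultiplication.MatrixMultiplication.Theorems.SoloInformedTinyHost

/-!
# Tiny host `ℤ/5`: zero-free sign data separate nothing twice

This work, §8.7 (h). Continuation of `SoloInformedTinyHost` (the case `S¹ = ℤ/3`). In the coprime case
of Conjecture C3 with fixed-point-free part `S¹ = ℤ/5` (multipliers `±1`) the nonzero elements fall
into the two sign classes `{±1}` (squares `= 1`) and `{±2}` (squares `= 4`), and for NONZERO values a
twisted triangle `u ± v ± w = 0` exists iff the three classes are NOT all equal (`zfree_triangle_iff`,
`zfree_separated_iff`). Hence ZERO-FREE `S¹`-data are three Boolean matrices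
`A : I × J`, `B : J × K`, `C : K × I` (the class bits) with

  (E)   no own triple `(A(i,j), B(j,k), C(k,i))` is monochromatic, for ALL `(i,j,k)`;
  (Sep) `τ = (i,j,k)`, `τ' = (i',j',k')` are separated iff BOTH mixed triples
        `(A(i,j), B(j',k), C(k',i'))` and `(A(i',j'), B(j,k'), C(k,i))` are monochromatic.

THEOREM (`ZFree.sep_forces_types`, `ZFree.no_three_separated`). Under (E), a separated pair consists of
a triple with own bits `A(τ) ≠ C(τ)` and a triple with the opposite pattern (`A(τ') = C(τ) ≠ A(τ)`);
consequently NO THREE triples are pairwise separated. So every fibre of the untwisted chart has at most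
two elements and a realization of `⟨n,n,n⟩` in `𝒮(S⁰ × ℤ/5, ±)` with zero-free `S¹`-data has
`|S⁰| ≥ n³/2`, rank `= 3|S⁰| ≥ 3n³/2` — far above Conjecture C3's demand. (With zeros allowed the lazy
twisted family `b ≡ 0`, `κa(i,·) ≡ κc(·,i) ≡ φ(i)` realizes `⟨n,n,n⟩` with `|S⁰| = n³/r`, `r = (q+1)/2`
sign classes, i.e. rank EXACTLY `n³` for every odd `q` — `lazy_eqn_iff`, `lazy_separated_iff`; the sharp
form C3♯ `rank ≥ n³` is tight along this whole family.) The proof of the theorem is five instances of (E).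
References: this work §8.7; CohnUmans2013 (arXiv:1207.6528) Def. 12, Conj. 21.
-/

namespace Summit.MatrixMultiplication.MatrixMultiplication.Theorems.TwistedTPP

namespace TinyHostFive

/-- Support/sign calculus in `ℤ/5`, nonzero values: a twisted triangle `u ± v ± w = 0` exists iff the
sign classes (read off from the squares `u·u ∈ {1,4}`) are not all equal. `decide` over `5³` cases. [this work, §8.7 (h)] -/
theorem zfree_triangle_iff (u v w : ZMod 5) (hu : u ≠ 0) (hv : v ≠ 0) (hw : w ≠ 0) :
    (u + v + w = 0 ∨ u + v - w = 0 ∨ u - v + w = 0 ∨ u - v - w = 0) ↔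
      ¬ (u * u = v * v ∧ v * v = w * w) := by
  have key : ∀ a b c : ZMod 5, a = 0 ∨ b = 0 ∨ c = 0 ∨
      ((a + b + c = 0 ∨ a + b - c = 0 ∨ a - b + c = 0 ∨ a - b - c = 0) ↔
        ¬ (a * a = b * b ∧ b * b = c * c)) := by
    decide
  rcases key u v w with h | h | h | h
  · exact absurd h hu
  · exact absurd h hv
  · exact absurd h hw
  · exact h

/-- Dually: a mixed triple of nonzero values is SEPARATING (no pattern vanishes) iff the three sign
classes coincide. [this work, §8.7 (h)] -/
theorem zfree_separated_iff (u v w : ZMod 5) (hu : u ≠ 0) (hv : v ≠ 0) (hw : w ≠ 0) :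
    (u + v + w ≠ 0 ∧ u + v - w ≠ 0 ∧ u - v + w ≠ 0 ∧ u - v - w ≠ 0) ↔
      (u * u = v * v ∧ v * v = w * w) := by
  have h := zfree_triangle_iff u v w hu hv hw
  tauto

/-- In `ℤ/5` the square of a nonzero element is `1` or `4`: two sign classes, so zero-free data are
Boolean. [this work, §8.7 (h)] -/
theorem sq_eq_one_or_four (u : ZMod 5) (hu : u ≠ 0) : u * u = 1 ∨ u * u = 4 := by
  have key : ∀ a : ZMod 5, a = 0 ∨ a * a = 1 ∨ a * a = 4 := by decide
  rcases key u with h | h | h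
  · exact absurd h hu
  · exact Or.inl h
  · exact Or.inr h

/-- The lazy twisted family (any abelian `S¹`, `b ≡ 0`): the own triple `(u, 0, w)` closes iff
`u = w ∨ u = -w` (same sign class) … [this work, §8.7 (h)] -/
theorem lazy_eqn_iff {S : Type*} [AddCommGroup S] (u w : S) :
    (u + 0 + w = 0 ∨ u + 0 - w = 0 ∨ u - 0 + w = 0 ∨ u - 0 - w = 0) ↔ (u = -w ∨ u = w) := by
  simp only [add_zero, sub_zero, add_eq_zero_iff_eq_neg, sub_eq_zero]
  tauto

/-- … and a mixed triple `(u, 0, w)` separates iff the classes differ; with `κa(i,·) ≡ κc(·,i) ≡ φ(i)`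
the fibres are the sets of triples over one `(j,k)` with pairwise distinct `φ`, of size `≤ r`.
[this work, §8.7 (h)] -/
theorem lazy_separated_iff {S : Type*} [AddCommGroup S] (u w : S) :
    (u + 0 + w ≠ 0 ∧ u + 0 - w ≠ 0 ∧ u - 0 + w ≠ 0 ∧ u - 0 - w ≠ 0) ↔ ¬ (u = -w ∨ u = w) := by
  rw [← lazy_eqn_iff]
  tauto

end TinyHostFive

/-- Zero-free sign data for `S¹ = ℤ/5`: the class bits of `a, b, c` with the triangle equations (E)
"no own triple is monochromatic". [this work, §8.7 (h)] -/
structure ZFree (G : Type*) where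
  /-- class bit of `a(i,j)` -/
  A : G → G → Bool
  /-- class bit of `b(j,k)` -/
  B : G → G → Bool
  /-- class bit of `c(k,i)` -/
  C : G → G → Bool
  /-- (E): for every `(i,j,k)` the own triple is not monochromatic -/
  eqn : ∀ i j k, ¬ (A i j = B j k ∧ B j k = C k i)

namespace ZFree

variable {G : Type*} (D : ZFree G)

/-- One direction of separation for the ordered pair `τ = (i,j,k)`, `τ' = (i',j',k')`: the mixed
triple `(A(i,j), B(j',k), C(k',i'))` is monochromatic. [this work, §8.7 (h)] -/
def SepDir (i j k i' j' k' : G) : Prop :=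
  D.A i j = D.B j' k ∧ D.B j' k = D.C k' i'

/-- **Type forcing.** If `τ = (i,j,k)` and `τ' = (i',j',k')` are separated (both directions) then the
own bits of `τ` satisfy `A(i,j) ≠ C(k,i)`: a triple whose `a`- and `c`-classes agree is separated from
nothing. Proof: five instances of (E), at `(i,j,k)`, `(i,j',k)`, `(i',j,k)`, `(i',j',k)`, `(i',j,k')`.
[this work, §8.7 (h)] -/
theorem sep_forces_types {i j k i' j' k' : G}
    (h₁ : D.SepDir i j k i' j' k') (h₂ : D.SepDir i' j' k' i j k) : D.A i j ≠ D.C k i := by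
  have e1 := D.eqn i j k
  have e2 := D.eqn i j' k
  have e3 := D.eqn i' j k
  have e4 := D.eqn i' j' k
  have e5 := D.eqn i' j k'
  unfold SepDir at h₁ h₂
  revert e1 e2 e3 e4 e5 h₁ h₂
  cases D.A i j <;> cases D.B j k <;> cases D.C k i <;> cases D.A i' j' <;> cases D.B j' k <;>
    cases D.C k' i' <;> cases D.B j k' <;> cases D.C k i' <;> cases D.A i' j <;> cases D.A i j' <;>
    simp

/-- The two members of a separated pair have opposite `a`-bits (and opposite `c`-bits).
[this work, §8.7 (h)] -/
theorem sep_opposite_bits {i j k i' j' k' : G}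
    (h₁ : D.SepDir i j k i' j' k') (h₂ : D.SepDir i' j' k' i j k) : D.A i j ≠ D.A i' j' := by
  have t₁ := D.sep_forces_types h₁ h₂
  unfold SepDir at h₁ h₂
  revert t₁ h₁ h₂
  cases D.A i j <;> cases D.C k i <;> cases D.A i' j' <;> cases D.B j k' <;> simp

/-- **No three pairwise separated triples** for zero-free `ℤ/5`-data: every fibre of the untwisted
chart has at most two elements, so `|S⁰| ≥ n³/2` and rank `≥ 3n³/2`. [this work, §8.7 (h)] -/
theorem no_three_separated {i₁ j₁ k₁ i₂ j₂ k₂ i₃ j₃ k₃ : G}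
    (h₁₂ : D.SepDir i₁ j₁ k₁ i₂ j₂ k₂) (h₂₁ : D.SepDir i₂ j₂ k₂ i₁ j₁ k₁)
    (h₁₃ : D.SepDir i₁ j₁ k₁ i₃ j₃ k₃) (h₃₁ : D.SepDir i₃ j₃ k₃ i₁ j₁ k₁)
    (h₂₃ : D.SepDir i₂ j₂ k₂ i₃ j₃ k₃) (h₃₂ : D.SepDir i₃ j₃ k₃ i₂ j₂ k₂) : False := by
  have a := D.sep_opposite_bits h₁₂ h₂₁
  have b := D.sep_opposite_bits h₁₃ h₃₁
  have c := D.sep_opposite_bits h₂₃ h₃₂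
  revert a b c
  cases D.A i₁ j₁ <;> cases D.A i₂ j₂ <;> cases D.A i₃ j₃ <;> simp

end ZFree

end Summit.MatrixMultiplication.MatrixMultiplication.Theorems.TwistedTPP
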